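import Summits.RiemannHypothesis.RiemannHypothesis.Theorems.TiltedLandingLaw421R3AntiEscapeSplit7
import Summits.RiemannHypothesis.RiemannHypothesis.Theorems.TiltedLandingLaw421R3RateSplit
import Summits.RiemannHypothesis.RiemannHypothesis.Theorems.TiltedLandingLaw421R3RealCritClose
import Summits.RiemannHypothesis.RiemannHypothesis.Theses.EarlyAppointments

/-! # trkD_v5q (half) — skeleton for `TiltedLandingLaw421R` at `halfPurse`: the two stubs ARE the residual laws of record
(SUCC `RhW08.AntiEscapeSplit7.DoorAvailLawQ`, #1122; RATE `RhW08.RateSplit.RateLawsHalfQ`, #1112); director (CA437). -/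

namespace Summit.RiemannHypothesis.RiemannHypothesis.Cruxes.TiltedLandingLaw421R.TrkDV5Q

set_option linter.dupNamespace false

theorem stub_doorAvailLawQ : RhW08.AntiEscapeSplit7.DoorAvailLawQ := by
  sorry

theorem stub_rateLawsHalfQ : RhW08.RateSplit.RateLawsHalfQ := by
  sorry

theorem TiltedLandingLaw421R_of : Summit.RiemannHypothesis.RiemannHypothesis.Theses.EarlyAppointments.TiltedLandingLaw421R :=
  RhW08.PurseP.law421Half_of_succ_rate
    (RhW08.AntiEscapeSplit7.restSuccBotQ_of_doorAvail RhW08.ClusterQM.realCritBoundNSig_holds stub_doorAvailLawQ)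
    (RhW08.RateSplit.restRateBotPQ_half_of_rateLaws stub_rateLawsHalfQ)

end Summit.RiemannHypothesis.RiemannHypothesis.Cruxes.TiltedLandingLaw421R.TrkDV5Q
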